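import Mathlib

/-! # Landau-type Tauberian step — crux stmt-NavierStokesRegularity-10493 (`AdaptedFrequency.AdaptedFrequencyConverges`), line tauberian-omega-limit, stub stub_landau

Pure real analysis (no PDE). Let `H : ℝ → ℝ` be differentiable on `[t₁, T)` with the two-sided
pinching `c₀ ≤ (T - t)² H t ≤ C₁` (`0 < c₀`), and suppose the "adapted frequency"
`Λ t := (T - t) H' t / H t` is slowly decreasing over fixed dyadic windows at `T`: for every
`ε > 0`, eventually `Λ t ≤ Λ t' + ε` whenever `t ≤ t' < T` and `T - t ≤ 2 (T - t')`.
Then `Λ t → 2` as `t ↑ T`.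

Proof outline. Put `f t := log ((T - t)² H t)`; then `log c₀ ≤ f ≤ log C₁` and
`f' t = (Λ t - 2) / (T - t)`. If `Λ a ≥ 2 + δ` at a late time `a`, chaining the slow-decrease
inequality over `N` consecutive dyadic windows `[T - (T-a)/2^k, T - (T-a)/2^(k+1)]` keeps
`Λ ≥ 2 + δ/2` on `[a, T - (T-a)/2^N]`, so `t ↦ f t + (δ/2) log (T - t)` is monotone there and
`f` gains at least `(δ/2) · N · log 2 > log C₁ - log c₀`, a contradiction; symmetrically (windows
run backwards from a late `b` with `Λ b ≤ 2 - δ`) for the lower bound. This is the fixed-window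
form of Landau's one-sided Tauberian theorem (Hardy, *Divergent Series*, §6.1, Thm 69 ff.;
Landau 1910); under two-sided pinching, boundedness of `f` (not convergence) suffices.
Triage r1-3 App. C. Everything here is Mathlib-only. -/

noncomputable section

open scoped Topology
open Set Filter

namespace Summit.NavierStokesRegularity.NavierStokesRegularity.Theorems.AdaptedFrequencyConverges.TauberianOmegaLimit

/-- Derivative of the comparison function `s ↦ log ((T - s)² H s) + κ log (T - s)` at a point
`t < T` where `H` is differentiable and positive: it equals `(Λ t - 2 - κ) / (T - t)` with
`Λ t = (T - t) H' t / H t`. -/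
theorem landau_hasDerivAt (T t κ : ℝ) (H : ℝ → ℝ) (ht : t < T) (hH : DifferentiableAt ℝ H t)
    (hpos : 0 < H t) :
    HasDerivAt (fun s => Real.log ((T - s) ^ 2 * H s) + κ * Real.log (T - s))
      (((T - t) * deriv H t / H t - 2 - κ) / (T - t)) t := by
  have h1 : HasDerivAt (fun s => T - s) (-1) t := by
    simpa using (hasDerivAt_id t).const_sub T
  have h2 : HasDerivAt (fun s => (T - s) ^ 2) (((2 : ℕ) : ℝ) * (T - t) ^ (2 - 1) * (-1)) t :=
    h1.fun_pow 2
  have h3 : HasDerivAt (fun s => (T - s) ^ 2 * H s)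
      (((2 : ℕ) : ℝ) * (T - t) ^ (2 - 1) * (-1) * H t + (T - t) ^ 2 * deriv H t) t :=
    h2.mul hH.hasDerivAt
  have hTt : 0 < T - t := sub_pos.2 ht
  have hF : (T - t) ^ 2 * H t ≠ 0 := by positivity
  have h4 := h3.log hF
  have h5 : HasDerivAt (fun s => κ * Real.log (T - s)) (κ * ((-1) / (T - t))) t :=
    (h1.log hTt.ne').const_mul κ
  refine (h4.add h5).congr_deriv ?_
  have hH0 : H t ≠ 0 := hpos.ne'
  field_simp
  ring

/-- Upper comparison: if `2 + η ≤ Λ` on `[a, b] ⊆ [t₁, T)`, then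
`η (log (T - a) - log (T - b)) ≤ log C₁ - log c₀`. -/
theorem landau_log_gain_le_of_le (T t₁ c₀ C₁ a b η : ℝ) (H : ℝ → ℝ)
    (hd : ∀ t ∈ Ico t₁ T, DifferentiableAt ℝ H t) (hc₀ : 0 < c₀)
    (hp : ∀ t ∈ Ico t₁ T, c₀ ≤ (T - t) ^ 2 * H t ∧ (T - t) ^ 2 * H t ≤ C₁)
    (ha : t₁ ≤ a) (hab : a ≤ b) (hb : b < T)
    (hΛ : ∀ t ∈ Icc a b, 2 + η ≤ (T - t) * deriv H t / H t) :
    η * (Real.log (T - a) - Real.log (T - b)) ≤ Real.log C₁ - Real.log c₀ := by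
  set g : ℝ → ℝ := fun s => Real.log ((T - s) ^ 2 * H s) + η * Real.log (T - s) with hg
  have hmem : ∀ t ∈ Icc a b, t ∈ Ico t₁ T := fun t ht => ⟨ha.trans ht.1, ht.2.trans_lt hb⟩
  have hHpos : ∀ t ∈ Icc a b, 0 < H t := by
    intro t ht
    have h1 := (hp t (hmem t ht)).1
    have hTt : 0 < T - t := sub_pos.2 (ht.2.trans_lt hb)
    by_contra hle
    have : (T - t) ^ 2 * H t ≤ 0 := mul_nonpos_of_nonneg_of_nonpos (by positivity) (not_lt.1 hle)
    linarith
  have hder : ∀ t ∈ Icc a b,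
      HasDerivAt g (((T - t) * deriv H t / H t - 2 - η) / (T - t)) t := fun t ht =>
    landau_hasDerivAt T t η H (ht.2.trans_lt hb) (hd t (hmem t ht)) (hHpos t ht)
  have hmono : MonotoneOn g (Icc a b) := by
    refine monotoneOn_of_deriv_nonneg (convex_Icc a b) ?_ ?_ ?_
    · exact fun t ht => (hder t ht).continuousAt.continuousWithinAt
    · rw [interior_Icc]
      exact fun t ht => (hder t (Ioo_subset_Icc_self ht)).differentiableAt.differentiableWithinAt
    · rw [interior_Icc]
      intro t ht
      rw [(hder t (Ioo_subset_Icc_self ht)).deriv]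
      have hTt : 0 < T - t := sub_pos.2 (ht.2.trans hb)
      have := hΛ t (Ioo_subset_Icc_self ht)
      exact div_nonneg (by linarith) hTt.le
  have hab' := hmono (left_mem_Icc.2 hab) (right_mem_Icc.2 hab) hab
  simp only [hg] at hab'
  have hFa := hp a (hmem a (left_mem_Icc.2 hab))
  have hFb := hp b (hmem b (right_mem_Icc.2 hab))
  have hla : Real.log c₀ ≤ Real.log ((T - a) ^ 2 * H a) := Real.log_le_log hc₀ hFa.1
  have hlb : Real.log ((T - b) ^ 2 * H b) ≤ Real.log C₁ :=
    Real.log_le_log (hc₀.trans_le hFb.1) hFb.2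
  linarith

/-- Lower comparison: if `Λ ≤ 2 - η` on `[a, b] ⊆ [t₁, T)`, then
`η (log (T - a) - log (T - b)) ≤ log C₁ - log c₀`. -/
theorem landau_log_gain_le_of_ge (T t₁ c₀ C₁ a b η : ℝ) (H : ℝ → ℝ)
    (hd : ∀ t ∈ Ico t₁ T, DifferentiableAt ℝ H t) (hc₀ : 0 < c₀)
    (hp : ∀ t ∈ Ico t₁ T, c₀ ≤ (T - t) ^ 2 * H t ∧ (T - t) ^ 2 * H t ≤ C₁)
    (ha : t₁ ≤ a) (hab : a ≤ b) (hb : b < T)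
    (hΛ : ∀ t ∈ Icc a b, (T - t) * deriv H t / H t ≤ 2 - η) :
    η * (Real.log (T - a) - Real.log (T - b)) ≤ Real.log C₁ - Real.log c₀ := by
  set g : ℝ → ℝ := fun s => Real.log ((T - s) ^ 2 * H s) + (-η) * Real.log (T - s) with hg
  have hmem : ∀ t ∈ Icc a b, t ∈ Ico t₁ T := fun t ht => ⟨ha.trans ht.1, ht.2.trans_lt hb⟩
  have hHpos : ∀ t ∈ Icc a b, 0 < H t := by
    intro t ht
    have h1 := (hp t (hmem t ht)).1
    have hTt : 0 < T - t := sub_pos.2 (ht.2.trans_lt hb)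
    by_contra hle
    have : (T - t) ^ 2 * H t ≤ 0 := mul_nonpos_of_nonneg_of_nonpos (by positivity) (not_lt.1 hle)
    linarith
  have hder : ∀ t ∈ Icc a b,
      HasDerivAt g (((T - t) * deriv H t / H t - 2 - (-η)) / (T - t)) t := fun t ht =>
    landau_hasDerivAt T t (-η) H (ht.2.trans_lt hb) (hd t (hmem t ht)) (hHpos t ht)
  have hanti : AntitoneOn g (Icc a b) := by
    refine antitoneOn_of_deriv_nonpos (convex_Icc a b) ?_ ?_ ?_
    · exact fun t ht => (hder t ht).continuousAt.continuousWithinAt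
    · rw [interior_Icc]
      exact fun t ht => (hder t (Ioo_subset_Icc_self ht)).differentiableAt.differentiableWithinAt
    · rw [interior_Icc]
      intro t ht
      rw [(hder t (Ioo_subset_Icc_self ht)).deriv]
      have hTt : 0 < T - t := sub_pos.2 (ht.2.trans hb)
      have := hΛ t (Ioo_subset_Icc_self ht)
      exact div_nonpos_of_nonpos_of_nonneg (by linarith) hTt.le
  have hab' := hanti (left_mem_Icc.2 hab) (right_mem_Icc.2 hab) hab
  simp only [hg] at hab'
  have hFa := hp a (hmem a (left_mem_Icc.2 hab))
  have hFb := hp b (hmem b (right_mem_Icc.2 hab))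
  have hla : Real.log ((T - a) ^ 2 * H a) ≤ Real.log C₁ :=
    Real.log_le_log (hc₀.trans_le hFa.1) hFa.2
  have hlb : Real.log c₀ ≤ Real.log ((T - b) ^ 2 * H b) := Real.log_le_log hc₀ hFb.1
  linarith

/-- Forward window chaining: if `Λ` is `ε`-slowly decreasing over dyadic windows after `t₂`
and `t₂ ≤ a < T`, then on `[a, T - (T - a)/2^k]` one has `Λ ≥ Λ a - k ε`. -/
theorem landau_window_forward (T t₂ a ε : ℝ) (Λ : ℝ → ℝ)
    (hsd : ∀ t t' : ℝ, t₂ ≤ t → t ≤ t' → t' < T → T - t ≤ 2 * (T - t') → Λ t ≤ Λ t' + ε)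
    (hε : 0 ≤ ε) (ha : t₂ ≤ a) (haT : a < T) :
    ∀ k : ℕ, ∀ t' ∈ Icc a (T - (T - a) / 2 ^ k), Λ a - k * ε ≤ Λ t' := by
  intro k
  induction k with
  | zero =>
    intro t' ht'
    simp only [pow_zero, div_one, sub_sub_cancel, Nat.cast_zero, zero_mul, sub_zero] at ht' ⊢
    rw [le_antisymm ht'.2 ht'.1]
  | succ k ih =>
    intro t' ht'
    have hpow : (0 : ℝ) < 2 ^ k := pow_pos two_pos k
    have hTa : 0 < T - a := sub_pos.2 haT
    have hpk_ge : a ≤ T - (T - a) / 2 ^ k := by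
      have h1 : (T - a) / 2 ^ k ≤ T - a := by
        rw [div_le_iff₀ hpow]
        have : (1 : ℝ) ≤ 2 ^ k := one_le_pow₀ (by norm_num)
        nlinarith
      linarith
    have hhalf : (T - a) / 2 ^ k = 2 * ((T - a) / 2 ^ (k + 1)) := by
      rw [pow_succ]
      field_simp
    rcases le_or_gt t' (T - (T - a) / 2 ^ k) with hle | hlt
    · have hih := ih t' ⟨ht'.1, hle⟩
      have hk : (k : ℝ) * ε ≤ (k + 1 : ℝ) * ε := by nlinarith
      push_cast
      linarith
    · have h1 : t₂ ≤ T - (T - a) / 2 ^ k := ha.trans hpk_ge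
      have h3 : t' < T := by
        have : 0 < (T - a) / 2 ^ (k + 1) := by positivity
        linarith [ht'.2]
      have h4 : T - (T - (T - a) / 2 ^ k) ≤ 2 * (T - t') := by linarith [ht'.2]
      have hstep := hsd _ _ h1 hlt.le h3 h4
      have hih := ih (T - (T - a) / 2 ^ k) ⟨hpk_ge, le_rfl⟩
      push_cast
      linarith

/-- Backward window chaining: if `Λ` is `ε`-slowly decreasing over dyadic windows after `t₂`,
`b < T` and `t₂ ≤ T - 2^k (T - b)`, then on `[T - 2^k (T - b), b]` one has `Λ ≤ Λ b + k ε`. -/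
theorem landau_window_backward (T t₂ b ε : ℝ) (Λ : ℝ → ℝ)
    (hsd : ∀ t t' : ℝ, t₂ ≤ t → t ≤ t' → t' < T → T - t ≤ 2 * (T - t') → Λ t ≤ Λ t' + ε)
    (hε : 0 ≤ ε) (hbT : b < T) :
    ∀ k : ℕ, t₂ ≤ T - 2 ^ k * (T - b) →
      ∀ t ∈ Icc (T - 2 ^ k * (T - b)) b, Λ t ≤ Λ b + k * ε := by
  intro k
  induction k with
  | zero =>
    intro _ t ht
    simp only [pow_zero, one_mul, sub_sub_cancel, Nat.cast_zero, zero_mul, add_zero] at ht ⊢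
    rw [le_antisymm ht.2 ht.1]
  | succ k ih =>
    intro ht₂ t ht
    have hpow : (1 : ℝ) ≤ 2 ^ k := one_le_pow₀ (by norm_num)
    have hTb : 0 < T - b := sub_pos.2 hbT
    have hsucc : (2 : ℝ) ^ (k + 1) * (T - b) = 2 * (2 ^ k * (T - b)) := by
      rw [pow_succ]
      ring
    have hqk : T - 2 ^ (k + 1) * (T - b) ≤ T - 2 ^ k * (T - b) := by nlinarith
    have ht₂' : t₂ ≤ T - 2 ^ k * (T - b) := ht₂.trans hqk
    rcases le_or_gt (T - 2 ^ k * (T - b)) t with hle | hlt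
    · have hih := ih ht₂' t ⟨hle, ht.2⟩
      have hk : (k : ℝ) * ε ≤ (k + 1 : ℝ) * ε := by nlinarith
      push_cast
      linarith
    · have h1 : t₂ ≤ t := ht₂.trans ht.1
      have h3 : T - 2 ^ k * (T - b) < T := by nlinarith
      have h4 : T - t ≤ 2 * (T - (T - 2 ^ k * (T - b))) := by linarith [ht.1]
      have hstep := hsd _ _ h1 hlt.le h3 h4
      have hqkb : T - 2 ^ k * (T - b) ≤ b := by nlinarith
      have hih := ih ht₂' _ ⟨le_rfl, hqkb⟩
      push_cast
      linarith

/-- **Landau-type Tauberian step** (pure real analysis): `H` differentiable on `[t₁, T)`,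
`(T−t)² H` pinched between positive constants, `(T−t) H′/H` slowly decreasing over fixed
log-windows at `T` ⇒ `(T−t) H′/H → 2` as `t ↑ T`. Fixed-window form of Landau's one-sided
Tauberian theorem (Hardy, *Divergent Series* §6.1). -/
theorem stub_landau :
    ∀ (T t₁ : ℝ) (H : ℝ → ℝ), t₁ < T → (∀ t ∈ Ico t₁ T, DifferentiableAt ℝ H t) → (∃ c₀ C₁ : ℝ, 0 < c₀ ∧ ∀ t ∈ Ico t₁ T, c₀ ≤ (T - t) ^ 2 * H t ∧ (T - t) ^ 2 * H t ≤ C₁) → (∀ ε : ℝ, 0 < ε → ∃ t₂ : ℝ, t₂ < T ∧ ∀ t t' : ℝ, t₂ ≤ t → t ≤ t' → t' < T → T - t ≤ 2 * (T - t') → (T - t) * deriv H t / H t ≤ (T - t') * deriv H t' / H t' + ε) → Tendsto (fun t => (T - t) * deriv H t / H t) (𝓝[<] T) (𝓝 2) := by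
  intro T t₁ H ht₁T hd hpin hsd
  obtain ⟨c₀, C₁, hc₀, hp⟩ := hpin
  rw [Metric.tendsto_nhds]
  intro δ hδ
  -- the oscillation budget `M`, the half-gap `η`, the number of windows `N`, the step `ε`
  set M : ℝ := Real.log C₁ - Real.log c₀ with hM
  have hlog2 : 0 < Real.log 2 := Real.log_pos one_lt_two
  set η : ℝ := δ / 2 with hη
  have hη0 : 0 < η := by positivity
  obtain ⟨N, hN1, hNM⟩ : ∃ N : ℕ, 0 < N ∧ M < η * N * Real.log 2 := by
    refine ⟨⌈M / (η * Real.log 2)⌉₊ + 1, Nat.succ_pos _, ?_⟩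
    have hpos : 0 < η * Real.log 2 := mul_pos hη0 hlog2
    have h1 : M / (η * Real.log 2) ≤ ⌈M / (η * Real.log 2)⌉₊ := Nat.le_ceil _
    have h2 : M / (η * Real.log 2) < ((⌈M / (η * Real.log 2)⌉₊ + 1 : ℕ) : ℝ) := by
      push_cast
      linarith
    rw [div_lt_iff₀ hpos] at h2
    linarith
  have hN0 : (0 : ℝ) < N := Nat.cast_pos.2 hN1
  set ε : ℝ := η / N with hε
  have hε0 : 0 < ε := div_pos hη0 hN0
  have hNε : (N : ℝ) * ε = η := by
    rw [hε]
    field_simp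
  obtain ⟨t₂, ht₂T, hsd₂⟩ := hsd ε hε0
  -- late times: `tm = max t₁ t₂`, and `tl`, which is `N` dyadic windows later
  set tm : ℝ := max t₁ t₂ with htm
  have htmT : tm < T := max_lt ht₁T ht₂T
  have hTtm : 0 < T - tm := sub_pos.2 htmT
  have h2N : (0 : ℝ) < 2 ^ N := pow_pos two_pos N
  have h2N1 : (1 : ℝ) ≤ 2 ^ N := one_le_pow₀ (by norm_num)
  set tl : ℝ := T - (T - tm) / 2 ^ N with htl
  have htlT : tl < T := by
    have : 0 < (T - tm) / 2 ^ N := by positivity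
    linarith
  have html : tm ≤ tl := by
    have : (T - tm) / 2 ^ N ≤ T - tm := by
      rw [div_le_iff₀ h2N]
      nlinarith
    linarith
  -- UPPER half: `Λ < 2 + δ` on `[tm, T)`
  have hup : ∀ a ∈ Ico tm T, (T - a) * deriv H a / H a < 2 + δ := by
    intro a ha
    by_contra hge
    have hge : 2 + δ ≤ (T - a) * deriv H a / H a := not_lt.1 hge
    have ht₂a : t₂ ≤ a := (le_max_right _ _).trans ha.1
    have ht₁a : t₁ ≤ a := (le_max_left _ _).trans ha.1
    have hTa : 0 < T - a := sub_pos.2 ha.2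
    have hwin := landau_window_forward T t₂ a ε (fun t => (T - t) * deriv H t / H t) hsd₂
      hε0.le ht₂a ha.2 N
    have hpN : T - (T - a) / 2 ^ N < T := by
      have : 0 < (T - a) / 2 ^ N := by positivity
      linarith
    have hapN : a ≤ T - (T - a) / 2 ^ N := by
      have : (T - a) / 2 ^ N ≤ T - a := by
        rw [div_le_iff₀ h2N]
        nlinarith
      linarith
    have hbound : ∀ t ∈ Icc a (T - (T - a) / 2 ^ N), 2 + η ≤ (T - t) * deriv H t / H t := by
      intro t ht
      have h := hwin t ht
      linarith
    have hgain := landau_log_gain_le_of_le T t₁ c₀ C₁ a (T - (T - a) / 2 ^ N) η H hd hc₀ hp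
      ht₁a hapN hpN hbound
    have hlog : Real.log (T - (T - (T - a) / 2 ^ N)) = Real.log (T - a) - N * Real.log 2 := by
      rw [sub_sub_cancel, Real.log_div hTa.ne' h2N.ne', Real.log_pow]
    rw [hlog] at hgain
    linarith
  -- LOWER half: `2 - δ < Λ` on `[tl, T)`
  have hlow : ∀ b ∈ Ico tl T, 2 - δ < (T - b) * deriv H b / H b := by
    intro b hb
    by_contra hle
    have hle : (T - b) * deriv H b / H b ≤ 2 - δ := not_lt.1 hle
    have hTb : 0 < T - b := sub_pos.2 hb.2
    have hqN : tm ≤ T - 2 ^ N * (T - b) := by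
      have h1 : T - b ≤ (T - tm) / 2 ^ N := by linarith [hb.1]
      rw [le_div_iff₀ h2N] at h1
      linarith
    have ht₂q : t₂ ≤ T - 2 ^ N * (T - b) := (le_max_right _ _).trans hqN
    have ht₁q : t₁ ≤ T - 2 ^ N * (T - b) := (le_max_left _ _).trans hqN
    have hwin := landau_window_backward T t₂ b ε (fun t => (T - t) * deriv H t / H t) hsd₂
      hε0.le hb.2 N ht₂q
    have hqb : T - 2 ^ N * (T - b) ≤ b := by nlinarith
    have hbound : ∀ t ∈ Icc (T - 2 ^ N * (T - b)) b, (T - t) * deriv H t / H t ≤ 2 - η := by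
      intro t ht
      have h := hwin t ht
      linarith
    have hgain := landau_log_gain_le_of_ge T t₁ c₀ C₁ (T - 2 ^ N * (T - b)) b η H hd hc₀ hp
      ht₁q hqb hb.2 hbound
    have hlog : Real.log (T - (T - 2 ^ N * (T - b))) = N * Real.log 2 + Real.log (T - b) := by
      rw [sub_sub_cancel, Real.log_mul (pow_ne_zero _ two_ne_zero) hTb.ne', Real.log_pow]
    rw [hlog] at hgain
    linarith
  -- LIMIT
  filter_upwards [Ico_mem_nhdsLT htlT] with t ht
  rw [Real.dist_eq, abs_sub_lt_iff]
  have h1 := hup t ⟨html.trans ht.1, ht.2⟩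
  have h2 := hlow t ht
  constructor <;> linarith

end Summit.NavierStokesRegularity.NavierStokesRegularity.Theorems.AdaptedFrequencyConverges.TauberianOmegaLimit

end
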